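import Literature.AlgebraicTopology.CharacteristicClasses.GrothendieckChernClasses
import Literature.AlgebraicTopology.SingularHomology.CupProductSupports
import HarnessLib

/-!
# The Whitney sum formula with a line bundle: `c(L ⊕ E) = (1 + c₁(L)) c(E)`

D. Husemoller, *Fibre Bundles* (3rd ed. 1994), Ch. 17 §6 Prop. 6.1 (proof): on `P(ξ)` the
tautological line `λ_ξ` projects onto the summands of `q^*ξ`; "let `Vᵢ` be the open subset over
which `sᵢ ≠ 0` … the cup product … is an element of `H*(E(Pξ), ⋃ Vᵢ) = 0`". We run this argument
for `S = L ⊕ E` with `L` a LINE bundle and `E` arbitrary (the inductive step of the Whitney sum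
formula, `WhitneySumFormula`): with `q : P(S) → B`, `x = e(λ_S)`, `y = q^*e(L)`,

* `V_L`, `V_E ⊆ P(S)`: the open sets where `λ_S → q^*L`, resp. `λ_S → q^*E`, is non-zero; they
  cover, and by normality of `P(S)` (paracompact Hausdorff) shrink to an open cover `O_L, O_E` with
  closures `C_L ⊆ V_L`, `C_E ⊆ V_E` (closed, hence paracompact);
* `(x - y)|_{C_L} = 0`: over `C_L`, `λ_S ≅ q^*L` (`map_xClass_eq_of_lineTarget`, a bundle map onto a
  line bundle, `eulerClass_bundleMap`); `R_E(x)|_{C_E} = 0` for the relation polynomial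
  `R_E(x) = xⁿ + Σ q^*c_{n-j}(E) xʲ`: over `C_E` the projection `ρ : C_E → P(E)` has `ρ^*x_E = x`
  (`ProjectiveBundleMap.map_lineEuler_eq`);
* hence `R_E(x) ⌣ (x - y) = 0` (`CupProductSupports`), which expanded is the defining relation of
  `S` for the family `c'_{m+1} = c_{m+1}(E) - e(L) ⌣ c_m(E)`; by uniqueness
  **`chernClassR_lineSum`: `c_{m+1}(L ⊕ E) = c_{m+1}(E) - e(L) ⌣ c_m(E)`**, i.e.
  `c(L ⊕ E) = (1 + c₁(L)) ⌣ c(E)` since **`c₁(L) = -e(L)`** (`chernClassR_one_of_rank_one`, from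
  `x_L = q^*e(L)`, `xClass_eq_of_rank_one`).

Everything is proved; no named facts.

## References

* D. Husemoller, *Fibre Bundles*, GTM 20, Springer 1994, Ch. 17 §6 Prop. 6.1, Thm. 6.2, §3 Prop. 3.3. [HusemollerFibreBundles1994]
-/

noncomputable section

open CategoryTheory Function Set Bundle Module Filter Literature.AlgebraicTopology.SingularHomology
  Literature.AlgebraicTopology.SingularHomology.LerayHirsch
open scoped LinearAlgebra.Projectivization Topology

namespace Literature.AlgebraicTopology.CharacteristicClasses

open ComplexVectorBundle

namespace ComplexVectorBundle

/-! ### The Whitney sum: projections and inclusions of total spaces -/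

section Prod

variable {B : Type} [TopologicalSpace B] (E₁ E₂ : ComplexVectorBundle.{0, 0} B)

/-- `E₁ ⊕ E₂ → E₁` is continuous. [folklore] -/
theorem continuous_directSum_fst :
    Continuous fun p : TotalSpace (E₁.directSum E₂).F (E₁.directSum E₂).E ↦ (⟨p.proj, p.2.1⟩ : TotalSpace E₁.F E₁.E) :=
  continuous_fst.comp (FiberBundle.Prod.isInducing_diag E₁.F E₁.E E₂.F E₂.E).continuous

/-- `E₁ ⊕ E₂ → E₂` is continuous. [folklore] -/
theorem continuous_directSum_snd :
    Continuous fun p : TotalSpace (E₁.directSum E₂).F (E₁.directSum E₂).E ↦ (⟨p.proj, p.2.2⟩ : TotalSpace E₂.F E₂.E) :=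
  continuous_snd.comp (FiberBundle.Prod.isInducing_diag E₁.F E₁.E E₂.F E₂.E).continuous

/-- A map into `E₁ ⊕ E₂` is continuous iff its two components are. [folklore] -/
theorem continuous_directSum_mk {Z : Type} [TopologicalSpace Z] (β : Z → B) (v₁ : ∀ z, E₁.E (β z)) (v₂ : ∀ z, E₂.E (β z))
    (h₁ : Continuous fun z ↦ (⟨β z, v₁ z⟩ : TotalSpace E₁.F E₁.E)) (h₂ : Continuous fun z ↦ (⟨β z, v₂ z⟩ : TotalSpace E₂.F E₂.E)) :
    Continuous fun z ↦ (⟨β z, (v₁ z, v₂ z)⟩ : TotalSpace (E₁.directSum E₂).F (E₁.directSum E₂).E) :=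
  (FiberBundle.Prod.isInducing_diag E₁.F E₁.E E₂.F E₂.E).continuous_iff.2 (h₁.prodMk h₂)

end Prod

/-! ### Bundle maps onto a line bundle: `ζ^*x_S = (q ∘ ζ)^* e(L)` -/

section LineTarget

variable {B : Type} [TopologicalSpace B] (S L : ComplexVectorBundle.{0, 0} B) (hS : 0 < S.rank)
  (φ : ∀ b, S.E b →ₗ[ℂ] L.E ((ContinuousMap.id B) b))
  (hΘ : Continuous fun p : TotalSpace S.F S.E ↦ (⟨(ContinuousMap.id B) p.proj, φ p.proj p.2⟩ : TotalSpace L.F L.E))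
  {Z : Type} [TopologicalSpace Z] (ζ : C(Z, S.Proj)) (hζ : ∀ z, ζ z ∈ S.mapDom L (S.k0 hS) φ)

/-- The fibres of `L` have dimension `rank L`. [folklore] -/
theorem finrank_fiber (b : B) : finrank ℂ (L.E b) = L.rank :=
  ((trivializationAt L.F L.E b).continuousLinearEquivAt ℂ b (FiberBundle.mem_baseSet_trivializationAt' b)).toLinearEquiv.finrank_eq

/-- The base map `q ∘ ζ`, typed as `𝟙 ∘ (q ∘ ζ)`. [folklore] -/
abbrev lineTargetBase : C(Z, B) := (ContinuousMap.id B).comp (S.projMap.comp ζ)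

/-- The linear equivalence `ℂ ≃ L_b`, `c ↦ c • w` for `w ≠ 0` in a line. [folklore] -/
def lineSpanEquiv (hL : L.rank = 1) {b : B} (w : L.E b) (hw : w ≠ 0) : ℂ ≃ₗ[ℂ] L.E b :=
  LinearEquiv.ofBijective (LinearMap.toSpanSingleton ℂ (L.E b) w)
    ⟨fun a a' h ↦ smul_left_injective ℂ hw h, fun v ↦ by
      have h1 : finrank ℂ (L.E b) = 1 := (L.finrank_fiber b).trans hL
      obtain ⟨c, hc⟩ := (finrank_eq_one_iff_of_nonzero' w hw).1 h1 v
      exact ⟨c, hc⟩⟩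

/-- **The fibre isomorphisms `(ζ^*λ_S)_z ≅ L_{q ζ z}`, `c ↦ c • φ(u(ζ z))`.** [cite: HusemollerFibreBundles1994, Ch. 17 §6 Prop. 6.1] -/
def lineTargetEquiv (hL : L.rank = 1) (z : Z) :
    ((ζ : Z → S.Proj) *ᵖ (S.lineBundle (S.k0 hS)).E) z ≃L[ℂ] L.E ((S.lineTargetBase ζ) z) where
  toLinearEquiv := L.lineSpanEquiv hL (S.imVec L (S.k0 hS) φ (ζ z)) (hζ z)
  continuous_toFun := by
    set b := (S.lineTargetBase ζ) z
    have hb : b ∈ (trivializationAt L.F L.E b).baseSet := FiberBundle.mem_baseSet_trivializationAt' b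
    set T := (trivializationAt L.F L.E b).continuousLinearEquivAt ℂ b hb
    have h1 : Continuous fun c : ℂ ↦ T.symm (c • T (S.imVec L (S.k0 hS) φ (ζ z))) :=
      T.symm.continuous.comp (continuous_id.smul continuous_const)
    refine (h1.congr fun c ↦ ?_ :)
    rw [← map_smul, ContinuousLinearEquiv.symm_apply_apply]
    rfl
  continuous_invFun := by
    set b := (S.lineTargetBase ζ) z
    have hb : b ∈ (trivializationAt L.F L.E b).baseSet := FiberBundle.mem_baseSet_trivializationAt' b
    set T := (trivializationAt L.F L.E b).continuousLinearEquivAt ℂ b hb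
    set e := L.lineSpanEquiv hL (S.imVec L (S.k0 hS) φ (ζ z)) (hζ z)
    have h1 : Continuous fun v : L.E b ↦ (e.symm.toLinearMap.comp T.symm.toLinearEquiv.toLinearMap) (T v) :=
      (LinearMap.continuous_of_finiteDimensional _).comp T.continuous
    refine (h1.congr fun v ↦ ?_ :)
    change e.symm (T.symm (T v)) = e.symm v
    rw [ContinuousLinearEquiv.symm_apply_apply]

/-- Its value on vectors: `c • φ(u(ζ z)) = φ(c • u(ζ z))`. [folklore] -/
theorem lineTargetEquiv_apply (hL : L.rank = 1) (z : Z) (c : ((ζ : Z → S.Proj) *ᵖ (S.lineBundle (S.k0 hS)).E) z) :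
    (S.lineTargetEquiv L hS φ ζ hζ hL z c : L.E _) =
      φ (ζ z).proj ((S.lineIncl (S.k0 hS) (Pullback.lift (ζ : Z → S.Proj) ⟨z, c⟩)).2) := by
  change (show ℂ from c) • φ (ζ z).proj (S.lineVecIn (S.k0 hS) (S.chartAt (S.k0 hS) (ζ z)) (ζ z)) =
    φ (ζ z).proj ((show ℂ from c) • S.lineVecIn (S.k0 hS) (S.chartAt (S.k0 hS) (ζ z)) (ζ z))
  rw [map_smul]

include hΘ in
/-- **The bundle map `ζ^*λ_S → L` over `q ∘ ζ` has a continuous total map** (`Θ ∘ (λ → S) ∘ lift`). [cite: HusemollerFibreBundles1994, Ch. 17 §6 Prop. 6.1] -/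
theorem continuous_lineTargetMap (hL : L.rank = 1) : Continuous fun p : TotalSpace (S.lineBundle (S.k0 hS)).F ((ζ : Z → S.Proj) *ᵖ (S.lineBundle (S.k0 hS)).E) ↦
    (⟨(S.lineTargetBase ζ) p.proj, S.lineTargetEquiv L hS φ ζ hζ hL p.proj p.2⟩ : TotalSpace L.F L.E) := by
  have h : Continuous fun p : TotalSpace (S.lineBundle (S.k0 hS)).F ((ζ : Z → S.Proj) *ᵖ (S.lineBundle (S.k0 hS)).E) ↦
      (⟨(ContinuousMap.id B) (S.lineIncl (S.k0 hS) (Pullback.lift (ζ : Z → S.Proj) p)).proj,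
        φ _ (S.lineIncl (S.k0 hS) (Pullback.lift (ζ : Z → S.Proj) p)).2⟩ : TotalSpace L.F L.E) :=
    hΘ.comp ((S.continuous_lineIncl (S.k0 hS)).comp (Pullback.continuous_lift (S.lineBundle (S.k0 hS)).F (S.lineBundle (S.k0 hS)).E _))
  convert h using 2 with p
  obtain ⟨z, c⟩ := p
  exact congrArg (TotalSpace.mk _) (S.lineTargetEquiv_apply L hS φ ζ hζ hL z c)

variable [T2Space B] [ParacompactSpace B] [T2Space Z] [ParacompactSpace Z] (R : Type) [CommRing R]

omit hS [T2Space B] [ParacompactSpace B] in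
/-- `dim_ℂ` of the model fibre of `L` is `1`. [folklore] -/
theorem finrank_of_rank_one (hL : L.rank = 1) : Module.finrank ℂ L.F = 1 := hL

/-- **`e(L)`**, the Euler class of the line bundle `L` (its `-c₁`). [cite: HusemollerFibreBundles1994, Ch. 17 §3] -/
abbrev eL (hL : L.rank = 1) (m : R) : singularCohomology R R B 2 := eulerClass L.F L.E (L.finrank_of_rank_one hL) R m

include hΘ hζ in
/-- **`ζ^* x_S = (q ∘ ζ)^* e(L)`** for `ζ : Z → V_φ ⊆ P(S)` from a paracompact Hausdorff `Z`
(over `V_φ` the tautological line maps isomorphically onto `q^*L`). [cite: HusemollerFibreBundles1994, Ch. 17 §6 Prop. 6.1] -/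
theorem map_xClass_eq_of_lineTarget (hL : L.rank = 1) (m : R) :
    singularCohomology.map R R ζ 2 (S.lineEuler (S.k0 hS) R m) = singularCohomology.map R R (S.lineTargetBase ζ) 2 (L.eL R hL m) := by
  rw [lineEuler, ← eulerClass_pullback]
  exact eulerClass_bundleMap (S.lineBundle (S.k0 hS)).F L.F ((ζ : Z → S.Proj) *ᵖ (S.lineBundle (S.k0 hS)).E) L.E
    (S.finrank_lineBundle (S.k0 hS)) (L.finrank_of_rank_one hL) R (g := S.lineTargetBase ζ)
    (S.lineTargetEquiv L hS φ ζ hζ hL) (S.continuous_lineTargetMap L hS φ hΘ ζ hζ hL) m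

end LineTarget

/-! ### Line bundles: `x = q^*e(L)` and `c₁(L) = -e(L)` -/

section RankOne

variable {B : Type} [TopologicalSpace B] [T2Space B] [ParacompactSpace B] (L : ComplexVectorBundle.{0, 0} B) (R : Type) [CommRing R]

omit [T2Space B] [ParacompactSpace B] in
/-- `rank L = 1 > 0`. [folklore] -/
theorem rank_pos_of_rank_one (hL : L.rank = 1) : 0 < L.rank := by omega

/-- **`x_L = q^* e(L)`** for a line bundle (`P(L) = B`, `λ_L = q^*L`). [cite: HusemollerFibreBundles1994, Ch. 17 Prop. 3.3 (proof of (C₃))] -/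
theorem xClass_eq_of_rank_one (hL : L.rank = 1) :
    L.xClass R (L.rank_pos_of_rank_one hL) = singularCohomology.map R R L.projMap 2 (L.eL R hL 1) := by
  let φ : ∀ b, L.E b →ₗ[ℂ] L.E ((ContinuousMap.id B) b) := fun b ↦ LinearMap.id
  have hζ : ∀ m : L.Proj, (ContinuousMap.id L.Proj) m ∈ L.mapDom L (L.k0 (L.rank_pos_of_rank_one hL)) φ := fun m ↦ by
    rw [L.mapDom_eq_univ L _ _ fun _ _ _ h ↦ h]; exact mem_univ _
  have h := L.map_xClass_eq_of_lineTarget L (L.rank_pos_of_rank_one hL) φ continuous_id (ContinuousMap.id L.Proj) hζ R hL 1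
  rw [singularCohomology.map_id] at h
  exact h

/-- **The Chern family of a line bundle: `(1, -e(L), 0, 0, …)`.** [cite: HusemollerFibreBundles1994, Ch. 17 Prop. 3.3] -/
def lineFamily (e : singularCohomology R R B 2) : (i : ℕ) → singularCohomology R R B (2 * i)
  | 0 => singularCohomology.one R B
  | 1 => -e
  | _ + 2 => 0

/-- It is a Chern family for `(q, x_L, 1)`. [cite: HusemollerFibreBundles1994, Ch. 17 Def. 2.6] -/
theorem isChernFamily_lineFamily (hL : L.rank = 1) : IsChernFamily R L.projMap (L.xClass R (L.rank_pos_of_rank_one hL)) 1 (lineFamily R (L.eL R hL 1)) where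
  zero := rfl
  eq_zero_of_lt i hi := by
    obtain ⟨k, rfl⟩ : ∃ k, i = k + 2 := ⟨i - 2, by omega⟩
    rfl
  rel := by
    rw [lhSum, Fin.sum_univ_one]
    change cupPow R _ 1 + cupProduct _ (singularCohomology.map R R L.projMap 2 (-(L.eL R hL 1))) (singularCohomology.one R _) = 0
    rw [map_neg, LinearMap.map_neg₂, cupProduct_one, cupPow_succ, cupPow_zero, ← L.xClass_eq_of_rank_one R hL]
    have : cupProduct (show 2 * 0 + 2 = 2 * (0 + 1) by omega) (singularCohomology.one R L.Proj) (L.xClass R (L.rank_pos_of_rank_one hL)) =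
        L.xClass R (L.rank_pos_of_rank_one hL) := one_cupProduct _
    rw [this, add_neg_cancel]

/-- **`c₁(L) = -e(L)` and `cᵢ(L) = 0` for `i ≥ 2`: `c(L) = (1, -e(L), 0, …)`.** [cite: HusemollerFibreBundles1994, Ch. 17 Prop. 3.3] -/
theorem chernClassR_of_rank_one (hL : L.rank = 1) : L.chernClassR R = lineFamily R (L.eL R hL 1) := by
  have key : ∀ n, n = 1 → IsChernFamily R L.projMap (L.xClass R (L.rank_pos_of_rank_one hL)) n (lineFamily R (L.eL R hL 1)) := by
    rintro n rfl
    exact L.isChernFamily_lineFamily R hL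
  exact (L.eq_chernClassR_of_isChernFamily R (L.rank_pos_of_rank_one hL) (key L.rank hL)).symm

/-- In particular `c₁(L) = -e(L)`. [cite: HusemollerFibreBundles1994, Ch. 17 Prop. 3.3] -/
theorem chernClassR_one_of_rank_one (hL : L.rank = 1) : L.chernClassR R 1 = -(L.eL R hL 1) := congrFun (L.chernClassR_of_rank_one R hL) 1

end RankOne

end ComplexVectorBundle

/-! ### The algebra of the expansion `R_E(x) ⌣ (x - y)` -/

section Algebra

variable (R : Type) [CommRing R] {X' B' : Type} [TopologicalSpace X'] [TopologicalSpace B'] (q : C(X', B'))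
  (x : singularCohomology R R X' 2) (eL : singularCohomology R R B' 2) (cE : (i : ℕ) → singularCohomology R R B' (2 * i))

/-- The generic term `q^*c ⌣ xᵖ ∈ Hᴷ` for `c ∈ H²ᵃ(B')`, `2a + 2p = K`. [folklore] -/
def lhT (K a p : ℕ) (h : 2 * a + 2 * p = K) (c : singularCohomology R R B' (2 * a)) : singularCohomology R R X' K :=
  cupProduct h (singularCohomology.map R R q (2 * a) c) (cupPow R x p)

/-- Index congruence for terms built from a family. [folklore] -/
theorem lhT_congr (f : (a : ℕ) → singularCohomology R R B' (2 * a)) {K a b : ℕ} (hab : a = b) (p : ℕ) (ha : 2 * a + 2 * p = K)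
    (hb : 2 * b + 2 * p = K) : lhT R q x K a p ha (f a) = lhT R q x K b p hb (f b) := by
  subst hab; rfl

/-- `lhSum` is a sum of `lhT`s. [folklore] -/
theorem lhSum_eq_sum_lhT {N K : ℕ} (a : Fin N → ℕ) (h : ∀ j, 2 * a j + 2 * (j : ℕ) = K) (f : (i : ℕ) → singularCohomology R R B' (2 * i)) :
    lhSum R q x (fun j ↦ 2 * a j) h (fun j ↦ f (a j)) = ∑ j, lhT R q x K (a j) j (h j) (f (a j)) := rfl

/-- Cup product with a sum on the left. [folklore] -/
theorem cupProduct_sum_left {ι : Type} (s : Finset ι) {p' q' n' : ℕ} (h : p' + q' = n') (T : ι → singularCohomology R R X' p')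
    (z : singularCohomology R R X' q') : cupProduct h (∑ j ∈ s, T j) z = ∑ j ∈ s, cupProduct h (T j) z := by
  rw [map_sum, LinearMap.sum_apply]

/-- **`(q^*c ⌣ xᵖ) ⌣ x = q^*c ⌣ xᵖ⁺¹`.** [cite: Hatcher2002, §3.2 p. 211] -/
theorem lhT_cup_x {K K' : ℕ} (hK : K + 2 = K') (a p : ℕ) (h : 2 * a + 2 * p = K) (h' : 2 * a + 2 * (p + 1) = K')
    (c : singularCohomology R R B' (2 * a)) : cupProduct hK (lhT R q x K a p h c) x = lhT R q x K' a (p + 1) h' c :=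
  cupProduct_assoc h (show 2 * p + 2 = 2 * (p + 1) by omega) hK h' _ _ _

/-- **`(q^*c ⌣ xᵖ) ⌣ q^*e = q^*(e ⌣ c) ⌣ xᵖ`** (even degrees commute). [cite: Hatcher2002, §3.2 Thm. 3.14] -/
theorem lhT_cup_y {K K' : ℕ} (hK : K + 2 = K') (a p : ℕ) (h : 2 * a + 2 * p = K) (h' : 2 * (a + 1) + 2 * p = K')
    (c : singularCohomology R R B' (2 * a)) :
    cupProduct hK (lhT R q x K a p h c) (singularCohomology.map R R q 2 eL) =
      lhT R q x K' (a + 1) p h' (cupProduct (show 2 + 2 * a = 2 * (a + 1) by omega) eL c) := by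
  rw [lhT, lhT, cupProduct_assoc h (show 2 * p + 2 = 2 * p + 2 from rfl) hK (show 2 * a + (2 * p + 2) = K' by omega),
    cupProduct_gradedComm_holds R X' (show 2 * p + 2 = 2 * p + 2 from rfl) (show 2 + 2 * p = 2 * p + 2 by omega),
    Even.neg_one_pow ⟨2 * p, by ring⟩, one_smul,
    ← cupProduct_assoc (show 2 * a + 2 = 2 * (a + 1) by omega) (show 2 + 2 * p = 2 * p + 2 by omega) h'
      (show 2 * a + (2 * p + 2) = K' by omega),
    cupProduct_gradedComm_holds R X' (show 2 * a + 2 = 2 * (a + 1) by omega) (show 2 + 2 * a = 2 * (a + 1) by omega),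
    Even.neg_one_pow ⟨2 * a, by ring⟩, one_smul, ← cupProduct_map]

/-- `xⁿ ⌣ q^*e = q^*e ⌣ xⁿ`, as a term with coefficient `e ⌣ 1`. [cite: Hatcher2002, §3.2 Thm. 3.14] -/
theorem cupPow_cup_y (n : ℕ) {K' : ℕ} (hK : 2 * n + 2 = K') (h1 : cE 0 = singularCohomology.one R B') :
    cupProduct hK (cupPow R x n) (singularCohomology.map R R q 2 eL) =
      lhT R q x K' (0 + 1) n (by omega) (cupProduct (show 2 + 2 * 0 = 2 * (0 + 1) by omega) eL (cE 0)) := by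
  rw [h1, cupProduct_one, lhT, cupProduct_gradedComm_holds R X' hK (show 2 + 2 * n = K' by omega), Even.neg_one_pow ⟨2 * n, by ring⟩,
    one_smul]

/-- **The product family `g(a) = e ⌣ c_{a-1} ∈ H²ᵃ`** (`0` for `a = 0`). [folklore] -/
def eProd (a : ℕ) : singularCohomology R R B' (2 * a) :=
  if ha : a = 0 then 0 else cupProduct (show 2 + 2 * (a - 1) = 2 * a by omega) eL (cE (a - 1))

/-- `g(b + 1) = e ⌣ c_b`. [folklore] -/
theorem eProd_succ (b : ℕ) : eProd R eL cE (b + 1) = cupProduct (show 2 + 2 * b = 2 * (b + 1) by omega) eL (cE b) := by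
  rw [eProd, dif_neg (Nat.succ_ne_zero b)]
  rfl

/-- **The Whitney family `c'(i) = c_E(i) - e ⌣ c_E(i-1)`, `c'(0) = 1`** (the Chern classes of
`L ⊕ E` in terms of those of `E` and `e = e(L) = -c₁(L)`). [cite: HusemollerFibreBundles1994, Ch. 17 Thm. 6.2] -/
def whitneyLine (i : ℕ) : singularCohomology R R B' (2 * i) :=
  if hi : i = 0 then degCast R (show 0 = 2 * i by omega) (singularCohomology.one R B') else cE i - eProd R eL cE i

/-- `c'(0) = 1`. [folklore] -/
theorem whitneyLine_zero : whitneyLine R eL cE 0 = singularCohomology.one R B' := by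
  rw [whitneyLine, dif_pos rfl]; rfl

/-- `c'(b+1) = c_E(b+1) - e ⌣ c_E(b)`. [folklore] -/
theorem whitneyLine_succ (b : ℕ) :
    whitneyLine R eL cE (b + 1) = cE (b + 1) - cupProduct (show 2 + 2 * b = 2 * (b + 1) by omega) eL (cE b) := by
  rw [whitneyLine, dif_neg (Nat.succ_ne_zero b), eProd_succ]

/-- **The relation polynomial `R_c(x) = xⁿ + Σ_{j<n} q^*c_{n-j} ⌣ xʲ`** of a family `c`. [cite: HusemollerFibreBundles1994, Ch. 17 Def. 2.6] -/
def relPoly (n : ℕ) (c : (i : ℕ) → singularCohomology R R B' (2 * i)) : singularCohomology R R X' (2 * n) :=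
  cupPow R x n + lhSum R q x (K := 2 * n) (fun j : Fin n ↦ 2 * (n - (j : ℕ))) (fun j ↦ by have := j.isLt; omega) (fun j ↦ c (n - j))

/-- `IsChernFamily.rel` is `relPoly = 0`. [folklore] -/
theorem isChernFamily_iff (n : ℕ) (c : (i : ℕ) → singularCohomology R R B' (2 * i)) :
    IsChernFamily R q x n c ↔ c 0 = singularCohomology.one R B' ∧ (∀ i, n < i → c i = 0) ∧ relPoly R q x n c = 0 :=
  ⟨fun h ↦ ⟨h.zero, h.eq_zero_of_lt, h.rel⟩, fun h ↦ ⟨h.1, h.2.1, h.2.2⟩⟩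

/-- The auxiliary terms `H_{j'} = q^*(e ⌣ c_{n-j'}) ⌣ x^{j'}`, `j' ≤ n`. [folklore] -/
def whitneyH (n : ℕ) (j' : Fin (n + 1)) : singularCohomology R R X' (2 * (n + 1)) :=
  lhT R q x (2 * (n + 1)) (n - j' + 1) j' (by have := j'.isLt; omega) (eProd R eL cE (n - j' + 1))

/-- **The expansion** `R_{c_E}(x) ⌣ (x - q^*e) = R_{c'}(x)` for the Whitney family `c'`
(`c_E(0) = 1`, `c_E(n+1) = 0`). [cite: HusemollerFibreBundles1994, Ch. 17 §6 Prop. 6.1 (proof)] -/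
theorem relPoly_cup (n : ℕ) (h0 : cE 0 = singularCohomology.one R B') (hn : cE (n + 1) = 0) :
    cupProduct (show 2 * n + 2 = 2 * (n + 1) by omega) (relPoly R q x n cE) (x - singularCohomology.map R R q 2 eL) =
      relPoly R q x (n + 1) (whitneyLine R eL cE) := by
  have hK : 2 * n + 2 = 2 * (n + 1) := by omega
  -- the pieces of the left-hand side
  have hA : ∀ j : Fin n, cupProduct hK (lhT R q x (2 * n) (n - j) j (by have := j.isLt; omega) (cE (n - j))) x =
      lhT R q x (2 * (n + 1)) (n - j) ((j : ℕ) + 1) (by have := j.isLt; omega) (cE (n - j)) := fun j ↦ lhT_cup_x R q x hK _ _ _ _ _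
  have hC : ∀ j : Fin n, cupProduct hK (lhT R q x (2 * n) (n - j) j (by have := j.isLt; omega) (cE (n - j))) (singularCohomology.map R R q 2 eL) =
      whitneyH R q x eL cE n (Fin.castSucc j) := fun j ↦ by
    rw [lhT_cup_y R q x eL hK _ _ _ (by have := j.isLt; omega), whitneyH, ← eProd_succ]
    exact lhT_congr R q x (fun a ↦ eProd R eL cE a) (by simp) _ _ _
  have hHcast : ∑ j', whitneyH R q x eL cE n j' = (∑ j : Fin n, whitneyH R q x eL cE n (Fin.castSucc j)) + whitneyH R q x eL cE n (Fin.last n) :=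
    Fin.sum_univ_castSucc _
  have hHsucc : ∑ j', whitneyH R q x eL cE n j' = whitneyH R q x eL cE n 0 + ∑ j : Fin n, whitneyH R q x eL cE n (Fin.succ j) :=
    Fin.sum_univ_succ _
  have hHlast : whitneyH R q x eL cE n (Fin.last n) = cupProduct hK (cupPow R x n) (singularCohomology.map R R q 2 eL) := by
    rw [cupPow_cup_y R q x eL cE n hK h0, whitneyH, ← eProd_succ]
    exact lhT_congr R q x (fun a ↦ eProd R eL cE a) (show n - (Fin.last n : ℕ) + 1 = 0 + 1 by simp) n _ _
  -- the left-hand side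
  have hL : cupProduct hK (relPoly R q x n cE) (x - singularCohomology.map R R q 2 eL) =
      (cupPow R x (n + 1) + ∑ j : Fin n, lhT R q x (2 * (n + 1)) (n - j) ((j : ℕ) + 1) (by have := j.isLt; omega) (cE (n - j))) -
        ∑ j', whitneyH R q x eL cE n j' := by
    rw [relPoly, lhSum_eq_sum_lhT R q x (fun j : Fin n ↦ n - (j : ℕ)), map_sub, LinearMap.map_add₂, LinearMap.map_add₂,
      cupProduct_sum_left, cupProduct_sum_left, hHcast, hHlast, Finset.sum_congr rfl (fun j _ ↦ hA j),
      Finset.sum_congr rfl (fun j _ ↦ hC j)]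
    have e1 : cupProduct hK (cupPow R x n) x = cupPow R x (n + 1) := rfl
    rw [e1]
    abel
  -- the right-hand side
  have hR : relPoly R q x (n + 1) (whitneyLine R eL cE) =
      cupPow R x (n + 1) + (∑ j : Fin n, (lhT R q x (2 * (n + 1)) (n - j) ((j : ℕ) + 1) (by have := j.isLt; omega) (cE (n - j)) -
        whitneyH R q x eL cE n (Fin.succ j)) - whitneyH R q x eL cE n 0) := by
    rw [relPoly, lhSum_eq_sum_lhT R q x (fun j : Fin (n + 1) ↦ n + 1 - (j : ℕ)), Fin.sum_univ_succ]
    congr 1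
    have e0 : lhT R q x (2 * (n + 1)) (n + 1 - ((0 : Fin (n + 1)) : ℕ)) ((0 : Fin (n + 1)) : ℕ) (by simp)
        (whitneyLine R eL cE (n + 1 - ((0 : Fin (n + 1)) : ℕ))) = -whitneyH R q x eL cE n 0 := by
      rw [lhT_congr R q x (whitneyLine R eL cE) (show n + 1 - ((0 : Fin (n + 1)) : ℕ) = n + 1 by simp) _ _ (by simp), whitneyLine_succ, hn,
        zero_sub, ← eProd_succ, lhT, map_neg, LinearMap.map_neg₂, whitneyH]
      congr 1
    have es : ∀ j : Fin n, lhT R q x (2 * (n + 1)) (n + 1 - ((Fin.succ j : Fin (n + 1)) : ℕ)) ((Fin.succ j : Fin (n + 1)) : ℕ)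
        (by have := j.isLt; rw [Fin.val_succ]; omega) (whitneyLine R eL cE (n + 1 - ((Fin.succ j : Fin (n + 1)) : ℕ))) =
        lhT R q x (2 * (n + 1)) (n - j) ((j : ℕ) + 1) (by have := j.isLt; omega) (cE (n - j)) - whitneyH R q x eL cE n (Fin.succ j) := by
      intro j
      have hj := j.isLt
      rw [lhT_congr R q x (whitneyLine R eL cE) (show n + 1 - ((Fin.succ j : Fin (n + 1)) : ℕ) = (n - j - 1) + 1 by rw [Fin.val_succ]; omega)
        _ _ (by rw [Fin.val_succ]; omega), whitneyLine_succ, lhT, map_sub, LinearMap.map_sub₂]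
      congr 1
      exact lhT_congr R q x cE (by omega) _ _ _
    rw [e0, Finset.sum_congr rfl (fun j _ ↦ es j)]
    abel
  rw [hL, hR, hHsucc]
  simp only [Finset.sum_sub_distrib]
  abel

end Algebra

namespace ComplexVectorBundle

/-! ### The line case of the Whitney sum formula -/

section LineCase

variable {B : Type} [TopologicalSpace B] [T2Space B] [ParacompactSpace B] (L E : ComplexVectorBundle.{0, 0} B) (R : Type) [CommRing R]

omit [T2Space B] [ParacompactSpace B] in
/-- `rank (L ⊕ E) = n + 1 > 0`. [folklore] -/
theorem rank_lineSum_pos (hL : L.rank = 1) : 0 < (L.directSum E).rank := by rw [rank_directSum]; omega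

omit [T2Space B] [ParacompactSpace B] in
/-- `rank (L ⊕ E) = rank E + 1`. [folklore] -/
theorem rank_lineSum (hL : L.rank = 1) : (L.directSum E).rank = E.rank + 1 := by rw [rank_directSum]; omega

/-- The projection `L ⊕ E → L`, fibrewise. [folklore] -/
abbrev φfst (b : B) : (L.directSum E).E b →ₗ[ℂ] L.E ((ContinuousMap.id B) b) := LinearMap.fst ℂ (L.E b) (E.E b)

/-- The projection `L ⊕ E → E`, fibrewise. [folklore] -/
abbrev φsnd (b : B) : (L.directSum E).E b →ₗ[ℂ] E.E ((ContinuousMap.id B) b) := LinearMap.snd ℂ (L.E b) (E.E b)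

omit [T2Space B] [ParacompactSpace B] in
/-- **`V_L ∪ V_E = P(L ⊕ E)`**: a line projects non-trivially to `L` or to `E`. [cite: HusemollerFibreBundles1994, Ch. 17 §6 Prop. 6.1] -/
theorem mapDom_fst_union_snd (hS : 0 < (L.directSum E).rank) :
    (L.directSum E).mapDom L ((L.directSum E).k0 hS) (L.φfst E) ∪ (L.directSum E).mapDom E ((L.directSum E).k0 hS) (L.φsnd E) = univ := by
  refine eq_univ_of_forall fun m ↦ ?_
  by_contra h
  simp only [mem_union, not_or] at h
  have h1 : (L.directSum E).imVec L ((L.directSum E).k0 hS) (L.φfst E) m = 0 := by simpa [mapDom] using h.1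
  have h2 : (L.directSum E).imVec E ((L.directSum E).k0 hS) (L.φsnd E) m = 0 := by simpa [mapDom] using h.2
  exact lineVecIn_ne_zero ((L.directSum E).mem_chartSet_chartAt _ m) (Prod.ext h1 h2)

omit [T2Space B] [ParacompactSpace B] in
/-- For `rank E = 0` the fibres of `E` are zero. [folklore] -/
theorem fiber_eq_zero_of_rank_eq_zero (hE : E.rank = 0) {b : B} (v : E.E b) : v = 0 := by
  set T := (trivializationAt E.F E.E b).continuousLinearEquivAt ℂ b (FiberBundle.mem_baseSet_trivializationAt' b)
  have h1 : T v = 0 := by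
    have : Module.finrank ℂ E.F = 0 := hE
    exact (finrank_zero_iff_forall_zero.1 this) (T v)
  simpa using congrArg T.symm h1

/-- **The vanishing `R_E(x)|_C = 0` on a closed `C ⊆ V_E`** (pull the relation of `E` back along
`ρ : C → P(E)`, `ρ^*x_E = x`). [cite: HusemollerFibreBundles1994, Ch. 17 §6 Prop. 6.1 (proof)] -/
theorem map_relPoly_eq_zero (hS : 0 < (L.directSum E).rank) {C : Set (L.directSum E).Proj} (hC : IsClosed C)
    (hCV : C ⊆ (L.directSum E).mapDom E ((L.directSum E).k0 hS) (L.φsnd E)) :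
    singularCohomology.map R R (subsetIncl C) (2 * E.rank)
      (relPoly R (L.directSum E).projMap ((L.directSum E).xClass R hS) E.rank (E.chernClassR R)) = 0 := by
  rcases Nat.eq_zero_or_pos E.rank with hE | hE
  · -- `V_E = ∅`, so `C = ∅`
    haveI : IsEmpty ↥C := ⟨fun z ↦ by
      have hz := hCV z.2
      exact hz (E.fiber_eq_zero_of_rank_eq_zero hE _)⟩
    exact ModuleCat.eq_zero_of_isZero_obj (isZero_singularCohomology_of_isEmpty' R ↥C _) _
  · haveI : ParacompactSpace ↥C := hC.isClosedEmbedding_subtypeVal.paracompactSpace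
    set ρ := (L.directSum E).projComp E ((L.directSum E).k0 hS) (L.φsnd E) (L.continuous_directSum_snd E) (subsetIncl C) fun z ↦ hCV z.2
    have hx : singularCohomology.map R R ρ 2 (E.xClass R hE) = singularCohomology.map R R (subsetIncl C) 2 ((L.directSum E).xClass R hS) :=
      ((L.directSum E).map_lineEuler_eq E ((L.directSum E).k0 hS) (E.k0 hE) (L.φsnd E) (L.continuous_directSum_snd E)
        (subsetIncl C) (fun z ↦ hCV z.2) R 1).symm
    have hfam := (E.isChernFamily_chernClassR R hE).comap ρ (ContinuousMap.id B) (q₁ := (L.directSum E).projMap.comp (subsetIncl C)) rfl hx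
    have h1 := hfam.rel
    -- `incl^* R_E(x)` is the same expression
    rw [relPoly, map_add, map_cupPow, map_lhSum R ((L.directSum E).projMap.comp (subsetIncl C)) (L.directSum E).projMap (subsetIncl C)
      (ContinuousMap.id B) rfl _ _ rfl]
    exact h1

/-- **The vanishing `(x - q^*e(L))|_C = 0` on a closed `C ⊆ V_L`.** [cite: HusemollerFibreBundles1994, Ch. 17 §6 Prop. 6.1 (proof)] -/
theorem map_sub_eq_zero (hL : L.rank = 1) (hS : 0 < (L.directSum E).rank) {C : Set (L.directSum E).Proj} (hC : IsClosed C)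
    (hCV : C ⊆ (L.directSum E).mapDom L ((L.directSum E).k0 hS) (L.φfst E)) :
    singularCohomology.map R R (subsetIncl C) 2
      ((L.directSum E).xClass R hS - singularCohomology.map R R (L.directSum E).projMap 2 (L.eL R hL 1)) = 0 := by
  haveI : ParacompactSpace ↥C := hC.isClosedEmbedding_subtypeVal.paracompactSpace
  have h := (L.directSum E).map_xClass_eq_of_lineTarget L hS (L.φfst E) (L.continuous_directSum_fst E) (subsetIncl C) (fun z ↦ hCV z.2) R hL 1
  rw [map_sub, sub_eq_zero, ← ModuleCat.comp_apply, ← singularCohomology.map_comp]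
  exact h

/-- **The key relation `R_E(x) ⌣ (x - q^*e(L)) = 0` in `H*(P(L ⊕ E))`** (shrink the cover
`V_L ∪ V_E`, vanish on the closures, multiply by supports). [cite: HusemollerFibreBundles1994, Ch. 17 §6 Prop. 6.1] -/
theorem relPoly_cup_sub_eq_zero (hL : L.rank = 1) (hS : 0 < (L.directSum E).rank) :
    cupProduct (show 2 * E.rank + 2 = 2 * (E.rank + 1) by omega)
      (relPoly R (L.directSum E).projMap ((L.directSum E).xClass R hS) E.rank (E.chernClassR R))
      ((L.directSum E).xClass R hS - singularCohomology.map R R (L.directSum E).projMap 2 (L.eL R hL 1)) = 0 := by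
  -- the open cover and its shrinking
  let U : Bool → Set (L.directSum E).Proj := fun b ↦ cond b ((L.directSum E).mapDom E ((L.directSum E).k0 hS) (L.φsnd E))
    ((L.directSum E).mapDom L ((L.directSum E).k0 hS) (L.φfst E))
  have hUo : ∀ b, IsOpen (U b) := by
    rintro (_ | _)
    · exact (L.directSum E).isOpen_mapDom L _ _ (L.continuous_directSum_fst E)
    · exact (L.directSum E).isOpen_mapDom E _ _ (L.continuous_directSum_snd E)
  have hUc : ⋃ b, U b = univ := by
    apply eq_univ_of_univ_subset
    rw [← L.mapDom_fst_union_snd E hS]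
    rintro m (hm | hm)
    · exact mem_iUnion.2 ⟨false, hm⟩
    · exact mem_iUnion.2 ⟨true, hm⟩
  obtain ⟨V, hVc, hVo, hVU⟩ := exists_iUnion_eq_closure_subset hUo (fun m ↦ Set.toFinite _) hUc
  have hE0 := L.map_relPoly_eq_zero E R hS isClosed_closure (hVU true)
  have hL0 := L.map_sub_eq_zero E R hL hS isClosed_closure (hVU false)
  -- restrict to the open sets and multiply
  have hE0' : singularCohomology.map R R (subsetIncl (V true)) (2 * E.rank)
      (relPoly R (L.directSum E).projMap ((L.directSum E).xClass R hS) E.rank (E.chernClassR R)) = 0 := by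
    rw [show subsetIncl (V true) = (subsetIncl (closure (V true))).comp ⟨Set.inclusion subset_closure, continuous_inclusion _⟩ from rfl,
      singularCohomology.map_comp, ModuleCat.comp_apply, hE0, map_zero]
  have hL0' : singularCohomology.map R R (subsetIncl (V false)) 2
      ((L.directSum E).xClass R hS - singularCohomology.map R R (L.directSum E).projMap 2 (L.eL R hL 1)) = 0 := by
    rw [show subsetIncl (V false) = (subsetIncl (closure (V false))).comp ⟨Set.inclusion subset_closure, continuous_inclusion _⟩ from rfl,
      singularCohomology.map_comp, ModuleCat.comp_apply, hL0, map_zero]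
  have hcov : (univ : Set (L.directSum E).Proj) ⊆ V true ∪ V false := by
    rw [← hVc]
    exact iUnion_subset fun b ↦ by cases b <;> simp [subset_union_left, subset_union_right]
  have h := map_cupProduct_eq_zero_of_isOpen (R := R) (hVo true) (hVo false) (show 2 * E.rank + 2 = 2 * (E.rank + 1) by omega) hE0' hL0' hcov
  exact (singularCohomology.mapIso R R (Homeomorph.Set.univ (L.directSum E).Proj) _).toLinearEquiv.injective (h.trans (map_zero _).symm)

/-- **The Whitney family is the Chern family of `L ⊕ E`.** [cite: HusemollerFibreBundles1994, Ch. 17 Thm. 6.2] -/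
theorem isChernFamily_whitneyLine (hL : L.rank = 1) (hS : 0 < (L.directSum E).rank) :
    IsChernFamily R (L.directSum E).projMap ((L.directSum E).xClass R hS) (E.rank + 1) (whitneyLine R (L.eL R hL 1) (E.chernClassR R)) := by
  rw [isChernFamily_iff]
  refine ⟨whitneyLine_zero R _ _, fun i hi ↦ ?_, ?_⟩
  · obtain ⟨b, rfl⟩ : ∃ b, i = b + 1 := ⟨i - 1, by omega⟩
    rw [whitneyLine_succ, E.chernClassR_eq_zero_of_lt R (by omega), E.chernClassR_eq_zero_of_lt R (by omega), LinearMap.map_zero, sub_zero]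
  · rw [← relPoly_cup R (L.directSum E).projMap ((L.directSum E).xClass R hS) (L.eL R hL 1) (E.chernClassR R) E.rank (E.chernClassR_zero R)
      (E.chernClassR_eq_zero_of_lt R (Nat.lt_succ_self _))]
    exact L.relPoly_cup_sub_eq_zero E R hL hS

/-- **The line case of the Whitney sum formula: `c(L ⊕ E) = c'`**, i.e. `c₀ = 1` and
`c_{m+1}(L ⊕ E) = c_{m+1}(E) - e(L) ⌣ c_m(E) = c_{m+1}(E) + c₁(L) ⌣ c_m(E)`. [cite: HusemollerFibreBundles1994, Ch. 17 Thm. 6.2] -/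
theorem chernClassR_lineSum (hL : L.rank = 1) : (L.directSum E).chernClassR R = whitneyLine R (L.eL R hL 1) (E.chernClassR R) := by
  have hS := L.rank_lineSum_pos E hL
  have key : ∀ N, N = E.rank + 1 → IsChernFamily R (L.directSum E).projMap ((L.directSum E).xClass R hS) N
      (whitneyLine R (L.eL R hL 1) (E.chernClassR R)) := by
    rintro N rfl
    exact L.isChernFamily_whitneyLine E R hL hS
  exact ((L.directSum E).eq_chernClassR_of_isChernFamily R hS (key _ (L.rank_lineSum E hL))).symm

/-- The same in degree `2(m+1)`: **`c_{m+1}(L ⊕ E) = c_{m+1}(E) - e(L) ⌣ c_m(E)`.** [cite: HusemollerFibreBundles1994, Ch. 17 Thm. 6.2] -/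
theorem chernClassR_lineSum_succ (hL : L.rank = 1) (m : ℕ) :
    (L.directSum E).chernClassR R (m + 1) = E.chernClassR R (m + 1) - cupProduct (show 2 + 2 * m = 2 * (m + 1) by omega) (L.eL R hL 1) (E.chernClassR R m) := by
  rw [L.chernClassR_lineSum E R hL, whitneyLine_succ]

end LineCase

end ComplexVectorBundle

end Literature.AlgebraicTopology.CharacteristicClasses
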